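import Summits.QuantumFields.BalabanUV.Beta.SpineRecursiveT2AllSocketsSU

/-!
# `BalabanUV.Beta.SecondOrderLetterLevels` — binder row D1, (L4): **THE TWO REMAINING LETTERS OF THE hR END FACTOR THROUGH LEVEL `0`**:
# `hBe ∀ j ⟸ ONE level-free fm-identity`, `hM2 ∀ j ⟸ ONE level-free kernel identity`, and the hR END re-stated over the LEVEL-`0` letters only
# (β sub-cell, ANALYSIS PROVER AN3 = the letter-socket fitter of row D1, lineage an3 gen 33; K-side wiring in an2's socket currency)

HONEST FRAMING (cell charter, verbatim): «discharging BetaPertH makes Balaban's UV stability UNCONDITIONAL — a real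
constructive-QFT result; it is NOT the continuum limit and NOT the Clay problem.»  DERIVED cell leaf (units bookkeeping, [folklore], entrywise
real algebra); no statement of Bałaban's papers is typed here, no `[cite:]` tag, no `def … : Prop` fact; EVERY LETTER IS STILL A HYPOTHESIS and the
file instantiates no binder of the β-function wall by itself.  NOT D1, NOT `BetaPertH`, NOT continuum, NOT Clay.

ABSOLUTE RULE (cell charter, verbatim): «No internally-minted statement may enter as a cited fact. Every hypothesis is either kernel-proved in this
package or a verbatim quotation of a PUBLISHED theorem with page reference. The manuscript(s) under audit are NOT citable for their own disputed
steps — they are the thing under adjudication; programme-internal (2001/route/tribunal) claims are never citable.»  Nothing is cited below.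

## What is here

The hR END of record `SpineRooted.axisReflectionCovariant_flipK_TbalOf_JsRecWAtOf_of_an1_letters` (`SpineRecursiveT2AllSockets`, an2-g19) and its
`SU(N)` instance `…_suN` (`SpineRecursiveT2AllSocketsSU`) take the two remaining letters of the second-order averaging jet UNIFORMLY IN THE LEVEL
`j`: (hBe) the exact anti-twin border law and (hM2) the mixed law.  Both factor through `j = 0` EXACTLY, by the tree's DEFINITIONS only:

* §1 BLOCKS.  On the field–multiplier entry `(inl β, inr m)` the recursive first-order table is its border part at every level,
  `SpureRecAt d Lc ρ cE cVH cΛ j κ u x z (inl β) (inr m) = (cVH·wVH d Lc j) · vhSAt ρ d Lc κ u x z (inl β) (inr m)` (`wilsonA` and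
  `e3OfK = −mmRead …` live on the field–field block), and `bhKStepAt d ρ Lc j x z (inl β) (inr m) = stepScale d Lc j · bhKAt d ρ Lc x z (inl β) (inr m)`.
* §2 WEIGHTS (`d + 1 = 4`, `r_j := ((Lc^j)^5)`): `wVH = r², stepScale = r, wB2 = wM2 = r³, wM1 = r²`, and under the END's `hγ`,
  `γ_j = −(Lc⁴/2)·r_j`; hence `cVH·wVH_j·γ_j`, `stepScale_j·γ_j²` and `wM1_j·γ_j` are `r_j³ ×` their level-`0` values.
* §3 BORDER.  By `SecondOrderStepLaw.conjW_diag_apply` the `(inl β, inr m)` entry of the level-`j` contact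
  `conjW (bhKStepAt j) (SpureRecAt j κ u) (SpureRecAt j κ′ u′) (diagK γ_j ĉt) (diagK γ_j ĉt′) (diagK γ_j² ĉt ĉt′)` is `wB2 j ×` the level-free entry, and
  `refK` is entrywise (`KernelReflection.refK_apply`): **`border_all_of_prim`** — hBe ∀ j from ONE level-free fm-identity (B₀) over `bhKAt`, `vhSAt`,
  `ctGen` with the END's constants `(cE, cVH, γ₀) = (Lc⁴, −Lc⁸/2, −Lc⁴/2)`; **`border_prim_of_zero`** — (B₀) ⟸ hBe at `j = 0`; the displayed
  **`borderPrim_iff_zero`** ((B₀) ⟺ K-I's hBe at `j := 0` VERBATIM) and **`border_all_of_zero`** (hBe(0) ⟹ hBe ∀ j).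
* §4 MIXED.  `M2Of 3 Lc mixFF j = wM2 j • mixFF`, `M1At … j = (cΛ·wM1 j) • hessFFAt`: **`mixed_all_of_prim`** — hM2 ∀ j, with residual
  `RM j α := wM2 3 Lc j • RM₀ α`, from ONE level-free kernel identity (M₀); the residual's class (`LocStencilFM`, `biLoc_smul`) and parity
  (`parityOdd_smul`) scale along (`locStencilFM_levels`, `parityOdd_levels`); the displayed **`mixedPrim_iff_zero`** ((M₀) with `RM 0` ⟺ K-I's hM2 at
  `j := 0` VERBATIM) and **`mixed_all_of_zero`** (hM2(0) ⟹ hM2 ∀ j with `RM′ j := wM2 3 Lc j • RM 0`).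
* §5 **THE hR END OVER THE LEVEL-`0` LETTERS ONLY**: `axisReflectionCovariant_flipK_TbalOf_JsRecWAtOf_of_an1_letters₀` (general colour basis) and
  `…_of_an1_letters₀_suN` — p219566 / p219752's conclusions from (B₀), (M₀) (+ the residual `RM₀`'s class and parity, lock2, the border table's
  data), i.e. from exactly the two identities an1's exact toy certified at one level (journal «RESULT-T2», an1-g28; evidence, not a theorem).

All declarations `[folklore]`; axioms standard.  Provenance: pub-balaban β sub-cell, unit beta-an3 gen 33, 2026-08-20 (v2 = v1 + the two displayed `iff`s and the `_of_zero` forms asked by the owner an2-g20); over an2-g19's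
`SpineRecursiveT2AllSocketsSU` BY NAME; no existing file touched.  NOT summit progress.
-/

open Finset
open scoped BigOperators
open Literature.MathematicalPhysics.QuantumFieldTheory
open Literature.MathematicalPhysics.QuantumFieldTheory.Balaban1983to89
open Literature.MathematicalPhysics.QuantumFieldTheory.Balaban1983to89.Beta
open ExpKernelCalculus (MKer Decays BiLoc comp tadpole VertexFamily VertexFamily₂ shiftK)
open AffineAveraging (box toSite)
open AveragingContoursRooted (ctr ctrOff ctrOff_mem_box)
open AveragingHessianKernelsRooted (vhSAt hessFFAt)
open AveragingMixedJetTables (mixFFAt)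
open PolarizationSign (reflSign AxisReflectionCovariant)
open KernelReflection (refK refK_apply)
open ResolventReflection (bref Φ)
open OneStepResolventKernel (Fib LocStencil JetData wsum)
open OneStepKernelFamily (KInvStep colH vertexOfK TbalOf flipK)
open ColourTrace (Complete TrOrthonormal)
open WilsonVertex2Sym (wsym22)
open StepJetData (wilsonA)
open B12Sec2to5 (l1 l1_nonneg)
open BalabanStepJetsSucc (wE wVH mmRead)
open BalabanCompositeJets (LocStencil₂)
open BalabanStepW2 (M2Of wV4 wB2 wM1 wM2)
open SecondOrderResponse (dM W2OfK W2SymOfK LocStencilFM vertex2OfK mixOfK K2OfK biLoc_smul)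
open Summit.QuantumFields.BalabanUV.Beta.TameKernelCalculus
open Summit.QuantumFields.BalabanUV.Beta.ChartConjugation (conjV conjW)
open Summit.QuantumFields.BalabanUV.Beta.AxialDressingRooted (coDressKBmAt)
open Summit.QuantumFields.BalabanUV.Beta.BorderedHessian (diagK ctGen bhKAt bhKStepAt bhKStepAt_zero bhKStepAt_succ_fm stepScale sgnK
  conjV_diagK_apply)
open Summit.QuantumFields.BalabanUV.Beta.SpineRecursiveParity (parityOdd_smul)
open Summit.QuantumFields.BalabanUV.Beta.SecondOrderStepLaw (conjW_diag_apply)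
open Summit.QuantumFields.BalabanUV.Beta.MixedJetTablesPlug (hmix_an1)
open Summit.QuantumFields.BalabanUV.Beta.ColourBasisSU (suGen suGen_complete suGen_trOrthonormal diagIndex ne_zero_of_two_le)
open Summit.QuantumFields.BalabanUV.Beta.SpineRooted

noncomputable section

namespace Summit.QuantumFields.BalabanUV.Beta.SecondOrderLetterLevels

/-! ## §1 The field–multiplier blocks of the recursive letters -/

section Blocks

variable {d : ℕ} {Lc : ℕ} [NeZero Lc]

/-- [folklore] On the field–multiplier block the recursive first-order table IS its weighted border part, at every level. -/
theorem SpureRecAt_inl_inr (ρ : Fin (d + 1) → ℤ) (cE cVH cΛ : ℝ) :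
    ∀ (j : ℕ) (κ : Fin (d + 1)) (u x z : Fin (d + 1) → ℤ) (β m : Fin (d + 1)),
      SpureRecAt d Lc ρ cE cVH cΛ j κ u x z (Sum.inl β) (Sum.inr m) = (cVH * wVH d Lc j) * vhSAt ρ d Lc rfl κ u x z (Sum.inl β) (Sum.inr m)
  | 0, κ, u, x, z, β, m => by
    rw [SpureRecAt_zero_level]
    simp only [Pi.add_apply, Pi.smul_apply, smul_eq_mul]
    rw [show wilsonA d κ u x z (Sum.inl β) (Sum.inr m) = 0 from rfl]
    simp [BalabanStepJetsSucc.wVH]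
  | j + 1, κ, u, x, z, β, m => by
    rw [SpureRecAt_succ]
    simp only [Pi.add_apply, Pi.smul_apply, smul_eq_mul]
    rw [show e3OfK Lc (coDressKBmAt ρ Lc (KInvStep (d := d) Lc j)) (WardLocusRecursive.SrecAt d Lc ρ cE cVH cΛ j) κ u x z (Sum.inl β) (Sum.inr m) = 0
      from neg_zero]
    ring

/-- [folklore] On the field–multiplier block the candidate step Hessian IS the scaled border of `bhKAt`, at every level. -/
theorem bhKStepAt_inl_inr (ρ : Fin (d + 1) → ℤ) :
    ∀ (j : ℕ) (x z : Fin (d + 1) → ℤ) (β m : Fin (d + 1)),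
      bhKStepAt d ρ Lc j x z (Sum.inl β) (Sum.inr m) = stepScale d Lc j * bhKAt d ρ Lc x z (Sum.inl β) (Sum.inr m)
  | 0, x, z, β, m => by rw [bhKStepAt_zero]; simp [BorderedHessian.stepScale]
  | j + 1, x, z, β, m => bhKStepAt_succ_fm j x z β m

end Blocks

/-! ## §2 The weights at `d + 1 = 4` as powers of `r_j := (Lc^j)^5`, and the canonical `γ` -/

section Weights

variable {Lc : ℕ} [NeZero Lc]

/-- [folklore] The step monomial `r_j := (Lc^j)^5` (`= M^{d+2}`, `M = Lc^j`, `d + 1 = 4`). -/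
def r (Lc j : ℕ) : ℝ := ((Lc : ℝ) ^ j) ^ 5

omit [NeZero Lc] in
/-- [folklore] `wVH = r²` at `d + 1 = 4`. -/
theorem wVH_eq (j : ℕ) : wVH 3 Lc j = r Lc j ^ 2 := by
  rw [BalabanStepJetsSucc.wVH, r]; ring

omit [NeZero Lc] in
/-- [folklore] `stepScale = r` at `d + 1 = 4`. -/
theorem stepScale_eq (j : ℕ) : stepScale 3 Lc j = r Lc j := rfl
omit [NeZero Lc] in
/-- [folklore] `wB2 = r³` at `d + 1 = 4`. -/
theorem wB2_eq (j : ℕ) : wB2 3 Lc j = r Lc j ^ 3 := by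
  rw [BalabanStepW2.wB2, r]; ring
omit [NeZero Lc] in
/-- [folklore] `wM2 = r³` at `d + 1 = 4`. -/
theorem wM2_eq (j : ℕ) : wM2 3 Lc j = r Lc j ^ 3 := by
  rw [BalabanStepW2.wM2, r]; ring
omit [NeZero Lc] in
/-- [folklore] `wM1 = r²` at `d + 1 = 4`. -/
theorem wM1_eq (j : ℕ) : wM1 3 Lc j = r Lc j ^ 2 := by
  rw [BalabanStepW2.wM1, r]; ring
omit [NeZero Lc] in
/-- [folklore] `r_0 = 1`. -/
theorem r_zero : r Lc 0 = 1 := by simp [r]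
/-- [folklore] `r_j ≠ 0` (`Lc ≠ 0`). -/
theorem r_ne_zero (j : ℕ) : r Lc j ≠ 0 :=
  pow_ne_zero _ (pow_ne_zero _ (by exact_mod_cast NeZero.ne Lc))
/-- [folklore] Under the END's `hγ`, `γ_j = −(Lc⁴/2)·r_j`. -/
theorem gamma_eq {γ : ℕ → ℝ} (hγ : ∀ j, γ j = -((Lc : ℝ) ^ 8 / 2) * wVH 3 Lc j / (stepScale 3 Lc j * (Lc : ℝ) ^ 4)) (j : ℕ) :
    γ j = -((Lc : ℝ) ^ 4 / 2) * r Lc j := by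
  have hL : (Lc : ℝ) ≠ 0 := by exact_mod_cast NeZero.ne Lc
  have hr : r Lc j ≠ 0 := r_ne_zero j
  rw [hγ j, wVH_eq, stepScale_eq, div_eq_iff (mul_ne_zero hr (pow_ne_zero _ hL))]
  ring

/-- [folklore] … in particular `γ_0 = −Lc⁴/2`. -/
theorem gamma_zero {γ : ℕ → ℝ} (hγ : ∀ j, γ j = -((Lc : ℝ) ^ 8 / 2) * wVH 3 Lc j / (stepScale 3 Lc j * (Lc : ℝ) ^ 4)) :
    γ 0 = -((Lc : ℝ) ^ 4 / 2) := by
  rw [gamma_eq hγ 0, r_zero, mul_one]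

end Weights

/-! ## §3 The border letter factors through level `0` -/

section Border

variable {Lc : ℕ} [NeZero Lc]

/-- THE LEVEL-FREE BORDER IDENTITY (B₀) — hBe of the hR END at `j = 0`, written over the primitive tables: `bhKAt` (rooted bordered Hessian),
`vhSAt` (an1's first-order border, weight `cVH = −Lc⁸/2`), the diagonal generator `ctGen` (coefficient `γ₀ = −Lc⁴/2`, second symbol `γ₀²·ĉt·ĉt′`),
for a border table `vh₂S` with weight `cB`; `fm`-entrywise.  A `Prop`-valued ABBREVIATION of a hypothesis shape (NOT a claimed fact). [folklore] -/
def BorderPrim (Lc : ℕ) (ρ : Fin 4 → ℤ) (cB : ℝ) (vh₂S : Fin 4 → (Fin 4 → ℤ) → Fin 4 → (Fin 4 → ℤ) → MKer 4 (Fib 3)) : Prop :=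
  ∀ (α : Fin 4) κ u κ' u' (x z : Fin 4 → ℤ) (β m : Fin 4),
    (cB • vh₂S κ (bref α κ u) κ' (bref α κ' u')) x z (Sum.inl β) (Sum.inr m) =
      ((reflSign α κ * reflSign α κ') • refK (Φ Lc α) (cB • vh₂S κ u κ' u' +
        conjW (bhKAt 3 ρ Lc) ((-((Lc : ℝ) ^ 8 / 2)) • vhSAt ρ 3 Lc rfl κ u) ((-((Lc : ℝ) ^ 8 / 2)) • vhSAt ρ 3 Lc rfl κ' u')
          (diagK fun p c => -((Lc : ℝ) ^ 4 / 2) * ctGen 3 α Lc κ u p c) (diagK fun p c => -((Lc : ℝ) ^ 4 / 2) * ctGen 3 α Lc κ' u' p c)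
          (diagK fun p c => (-((Lc : ℝ) ^ 4 / 2)) ^ 2 * (ctGen 3 α Lc κ u p c * ctGen 3 α Lc κ' u' p c)))) x z (Sum.inl β) (Sum.inr m)

/-- THE LEVEL-`j` BORDER LETTER hBe of the hR END (shape copied verbatim from `SpineRecursiveT2AllSockets`), as a `Prop`-valued abbreviation
(a hypothesis shape, NOT a claimed fact). [folklore] -/
def BorderAt (Lc : ℕ) [NeZero Lc] (ρ : Fin 4 → ℤ) (cΛ cB : ℝ) (γ : ℕ → ℝ)
    (vh₂S : Fin 4 → (Fin 4 → ℤ) → Fin 4 → (Fin 4 → ℤ) → MKer 4 (Fib 3)) (j : ℕ) : Prop :=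
  ∀ (α : Fin 4) κ u κ' u' (x z : Fin 4 → ℤ) (β m : Fin 4),
    ((cB * wB2 3 Lc j) • vh₂S κ (bref α κ u) κ' (bref α κ' u')) x z (Sum.inl β) (Sum.inr m) =
      ((reflSign α κ * reflSign α κ') • refK (Φ Lc α) ((cB * wB2 3 Lc j) • vh₂S κ u κ' u' +
        conjW (bhKStepAt 3 ρ Lc j)
          (SpureRecAt 3 Lc ρ ((Lc : ℝ) ^ 4) (-((Lc : ℝ) ^ 8 / 2)) cΛ j κ u)
          (SpureRecAt 3 Lc ρ ((Lc : ℝ) ^ 4) (-((Lc : ℝ) ^ 8 / 2)) cΛ j κ' u')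
          (diagK fun p c => γ j * ctGen 3 α Lc κ u p c) (diagK fun p c => γ j * ctGen 3 α Lc κ' u' p c)
          (diagK fun p c => γ j ^ 2 * (ctGen 3 α Lc κ u p c * ctGen 3 α Lc κ' u' p c)))) x z (Sum.inl β) (Sum.inr m)

/-- [folklore] **THE BORDER LETTER ∀ j ⟸ THE LEVEL-FREE IDENTITY (B₀).**  Entry by entry, the level-`j` letter is `wB2 j = r_j³` times (B₀). -/
theorem border_all_of_prim (ρ : Fin 4 → ℤ) (cΛ cB : ℝ) {γ : ℕ → ℝ}
    (hγ : ∀ j, γ j = -((Lc : ℝ) ^ 8 / 2) * wVH 3 Lc j / (stepScale 3 Lc j * (Lc : ℝ) ^ 4))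
    {vh₂S : Fin 4 → (Fin 4 → ℤ) → Fin 4 → (Fin 4 → ℤ) → MKer 4 (Fib 3)} (h0 : BorderPrim Lc ρ cB vh₂S) :
    ∀ j, BorderAt Lc ρ cΛ cB γ vh₂S j := by
  intro j α κ u κ' u' x z β m
  have h := h0 α κ u κ' u' x z β m
  simp only [Pi.smul_apply, Pi.add_apply, smul_eq_mul, refK_apply, conjW_diag_apply, SpureRecAt_inl_inr, bhKStepAt_inl_inr] at h ⊢
  rw [gamma_eq hγ j, wVH_eq, stepScale_eq, wB2_eq]
  linear_combination (r Lc j) ^ 3 * h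

/-- [folklore] **(B₀) ⟸ THE BORDER LETTER AT LEVEL `0`** (so (B₀) is exactly hBe(0), re-lettered). -/
theorem border_prim_of_zero (ρ : Fin 4 → ℤ) (cΛ cB : ℝ) {γ : ℕ → ℝ}
    (hγ : ∀ j, γ j = -((Lc : ℝ) ^ 8 / 2) * wVH 3 Lc j / (stepScale 3 Lc j * (Lc : ℝ) ^ 4))
    {vh₂S : Fin 4 → (Fin 4 → ℤ) → Fin 4 → (Fin 4 → ℤ) → MKer 4 (Fib 3)} (h0 : BorderAt Lc ρ cΛ cB γ vh₂S 0) :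
    BorderPrim Lc ρ cB vh₂S := by
  intro α κ u κ' u' x z β m
  have h := h0 α κ u κ' u' x z β m
  simp only [Pi.smul_apply, Pi.add_apply, smul_eq_mul, refK_apply, conjW_diag_apply, SpureRecAt_inl_inr, bhKStepAt_inl_inr] at h ⊢
  rw [gamma_zero hγ, wVH_eq, stepScale_eq, wB2_eq, r_zero] at h
  linear_combination h

/-- [folklore] **(B₀) ⟺ hBe AT LEVEL `0`** — the displayed `iff` (owner's request, journal l.14674 (B1)): the unfolded `bhKAt`∕`vhSAt`∕`ctGen` form IS
the `j := 0` instance of K-I's hBe (`bhKStepAt 3 ρ Lc 0`, `SpureRecAt … 0`, `γ 0`, `wB2 3 Lc 0`). -/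
theorem borderPrim_iff_zero (ρ : Fin 4 → ℤ) (cΛ cB : ℝ) {γ : ℕ → ℝ}
    (hγ : ∀ j, γ j = -((Lc : ℝ) ^ 8 / 2) * wVH 3 Lc j / (stepScale 3 Lc j * (Lc : ℝ) ^ 4))
    (vh₂S : Fin 4 → (Fin 4 → ℤ) → Fin 4 → (Fin 4 → ℤ) → MKer 4 (Fib 3)) :
    BorderPrim Lc ρ cB vh₂S ↔ BorderAt Lc ρ cΛ cB γ vh₂S 0 :=
  ⟨fun h => border_all_of_prim ρ cΛ cB hγ h 0, border_prim_of_zero ρ cΛ cB hγ⟩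

/-- [folklore] **THE BORDER LETTER ∀ j ⟸ THE BORDER LETTER AT LEVEL `0`** (K-I's hBe, `j := 0` instance VERBATIM ⟹ every level). -/
theorem border_all_of_zero (ρ : Fin 4 → ℤ) (cΛ cB : ℝ) {γ : ℕ → ℝ}
    (hγ : ∀ j, γ j = -((Lc : ℝ) ^ 8 / 2) * wVH 3 Lc j / (stepScale 3 Lc j * (Lc : ℝ) ^ 4))
    {vh₂S : Fin 4 → (Fin 4 → ℤ) → Fin 4 → (Fin 4 → ℤ) → MKer 4 (Fib 3)} (h0 : BorderAt Lc ρ cΛ cB γ vh₂S 0) :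
    ∀ j, BorderAt Lc ρ cΛ cB γ vh₂S j :=
  border_all_of_prim ρ cΛ cB hγ (border_prim_of_zero ρ cΛ cB hγ h0)

end Border

/-! ## §4 The mixed letter factors through level `0` -/

section Mixed

variable {Lc : ℕ} [NeZero Lc]

/-- THE LEVEL-FREE MIXED IDENTITY (M₀) — hM2 of the hR END at `j = 0`, over the primitive tables `mixFF` (weight `1`), `hessFFAt` (an1's
constraint Hessian, weight `cΛ`) and `ctGen` (coefficient `γ₀ = −Lc⁴/2`), with a level-free residual `RM₀`.  A `Prop`-valued abbreviation
(a hypothesis shape, NOT a claimed fact). [folklore] -/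
def MixedPrim (Lc : ℕ) (ρ : Fin 4 → ℤ) (cΛ : ℝ)
    (mixFF : Fin 4 → (Fin 4 → ℤ) → Fin 4 → (Fin 4 → ℤ) → MKer 4 (Fib 3))
    (RM₀ : Fin 4 → Fin 4 → (Fin 4 → ℤ) → Fin 4 → (Fin 4 → ℤ) → MKer 4 (Fib 3)) : Prop :=
  ∀ (α κ : Fin 4) (u : Fin 4 → ℤ) (ρ' : Fin 4) (w : Fin 4 → ℤ),
    mixFF κ (bref α κ u) ρ' (bref α ρ' w) =
      (reflSign α κ * reflSign α ρ') • refK (Φ Lc α)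
        (mixFF κ u ρ' w + conjV (cΛ • hessFFAt ρ Lc ρ' w) (diagK fun p c => -((Lc : ℝ) ^ 4 / 2) * ctGen 3 α Lc κ u p c) + RM₀ α κ u ρ' w)

/-- THE LEVEL-`j` MIXED LETTER hM2 of the hR END (shape verbatim), as a `Prop`-valued abbreviation (a hypothesis shape, NOT a claimed fact).
[folklore] -/
def MixedAt (Lc : ℕ) [NeZero Lc] (ρ : Fin 4 → ℤ) (cΛ : ℝ) (γ : ℕ → ℝ)
    (mixFF : Fin 4 → (Fin 4 → ℤ) → Fin 4 → (Fin 4 → ℤ) → MKer 4 (Fib 3))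
    (RM : ℕ → Fin 4 → Fin 4 → (Fin 4 → ℤ) → Fin 4 → (Fin 4 → ℤ) → MKer 4 (Fib 3)) (j : ℕ) : Prop :=
  ∀ (α κ : Fin 4) (u : Fin 4 → ℤ) (ρ' : Fin 4) (w : Fin 4 → ℤ),
    M2Of 3 Lc mixFF j κ (bref α κ u) ρ' (bref α ρ' w) =
      (reflSign α κ * reflSign α ρ') • refK (Φ Lc α)
        (M2Of 3 Lc mixFF j κ u ρ' w + conjV (M1At 3 Lc ρ cΛ j ρ' w) (diagK fun p c => γ j * ctGen 3 α Lc κ u p c) + RM j α κ u ρ' w)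

/-- [folklore] The level-`j` residual family generated by a level-free one: `RM j α := wM2 3 Lc j • RM₀ α`. -/
def levels (Lc : ℕ) (RM₀ : Fin 4 → Fin 4 → (Fin 4 → ℤ) → Fin 4 → (Fin 4 → ℤ) → MKer 4 (Fib 3)) :
    ℕ → Fin 4 → Fin 4 → (Fin 4 → ℤ) → Fin 4 → (Fin 4 → ℤ) → MKer 4 (Fib 3) :=
  fun j α κ u ρ' w => wM2 3 Lc j • RM₀ α κ u ρ' w

/-- [folklore] **THE MIXED LETTER ∀ j ⟸ THE LEVEL-FREE IDENTITY (M₀)**, with the residual family `levels Lc RM₀`. -/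
theorem mixed_all_of_prim (ρ : Fin 4 → ℤ) (cΛ : ℝ) {γ : ℕ → ℝ}
    (hγ : ∀ j, γ j = -((Lc : ℝ) ^ 8 / 2) * wVH 3 Lc j / (stepScale 3 Lc j * (Lc : ℝ) ^ 4))
    {mixFF : Fin 4 → (Fin 4 → ℤ) → Fin 4 → (Fin 4 → ℤ) → MKer 4 (Fib 3)}
    {RM₀ : Fin 4 → Fin 4 → (Fin 4 → ℤ) → Fin 4 → (Fin 4 → ℤ) → MKer 4 (Fib 3)} (h0 : MixedPrim Lc ρ cΛ mixFF RM₀) :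
    ∀ j, MixedAt Lc ρ cΛ γ mixFF (levels Lc RM₀) j := by
  intro j α κ u ρ' w
  funext x z a b
  have h := congrArg (fun K : MKer 4 (Fib 3) => K x z a b) (h0 α κ u ρ' w)
  simp only [BalabanStepW2.M2Of, M1At, levels, Pi.smul_apply, Pi.add_apply, smul_eq_mul, refK_apply, conjV_diagK_apply] at h ⊢
  rw [gamma_eq hγ j, wM1_eq, wM2_eq]
  linear_combination (r Lc j) ^ 3 * h

/-- [folklore] **(M₀) ⟸ THE MIXED LETTER AT LEVEL `0`** (with `RM₀ := RM 0`). -/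
theorem mixed_prim_of_zero (ρ : Fin 4 → ℤ) (cΛ : ℝ) {γ : ℕ → ℝ}
    (hγ : ∀ j, γ j = -((Lc : ℝ) ^ 8 / 2) * wVH 3 Lc j / (stepScale 3 Lc j * (Lc : ℝ) ^ 4))
    {mixFF : Fin 4 → (Fin 4 → ℤ) → Fin 4 → (Fin 4 → ℤ) → MKer 4 (Fib 3)}
    {RM : ℕ → Fin 4 → Fin 4 → (Fin 4 → ℤ) → Fin 4 → (Fin 4 → ℤ) → MKer 4 (Fib 3)} (h0 : MixedAt Lc ρ cΛ γ mixFF RM 0) :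
    MixedPrim Lc ρ cΛ mixFF (RM 0) := by
  intro α κ u ρ' w
  funext x z a b
  have h := congrArg (fun K : MKer 4 (Fib 3) => K x z a b) (h0 α κ u ρ' w)
  simp only [BalabanStepW2.M2Of, M1At, Pi.smul_apply, Pi.add_apply, smul_eq_mul, refK_apply, conjV_diagK_apply] at h ⊢
  rw [gamma_zero hγ, wM1_eq, wM2_eq, r_zero] at h
  linear_combination h

omit [NeZero Lc] in
/-- [folklore] At level `0` the generated residual family is the generating table: `levels Lc RM₀ 0 = RM₀`. -/
theorem levels_zero (RM₀ : Fin 4 → Fin 4 → (Fin 4 → ℤ) → Fin 4 → (Fin 4 → ℤ) → MKer 4 (Fib 3)) : levels Lc RM₀ 0 = RM₀ := by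
  funext α κ u ρ' w
  rw [levels, wM2_eq, r_zero, one_pow, one_smul]

/-- [folklore] **(M₀) ⟺ hM2 AT LEVEL `0`** — the displayed `iff` (owner's request, journal l.14674 (B1)): the unfolded `mixFF`∕`hessFFAt`∕`ctGen` form with
residual `RM 0` IS the `j := 0` instance of K-I's hM2 (`M2Of 3 Lc mixFF 0`, `M1At 3 Lc ρ cΛ 0`, `γ 0`). -/
theorem mixedPrim_iff_zero (ρ : Fin 4 → ℤ) (cΛ : ℝ) {γ : ℕ → ℝ}
    (hγ : ∀ j, γ j = -((Lc : ℝ) ^ 8 / 2) * wVH 3 Lc j / (stepScale 3 Lc j * (Lc : ℝ) ^ 4))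
    (mixFF : Fin 4 → (Fin 4 → ℤ) → Fin 4 → (Fin 4 → ℤ) → MKer 4 (Fib 3))
    (RM : ℕ → Fin 4 → Fin 4 → (Fin 4 → ℤ) → Fin 4 → (Fin 4 → ℤ) → MKer 4 (Fib 3)) :
    MixedPrim Lc ρ cΛ mixFF (RM 0) ↔ MixedAt Lc ρ cΛ γ mixFF RM 0 := by
  refine ⟨fun h α κ u ρ' w => ?_, mixed_prim_of_zero ρ cΛ hγ⟩
  have h' := mixed_all_of_prim ρ cΛ hγ h 0 α κ u ρ' w
  rw [levels_zero] at h'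
  exact h'

/-- [folklore] **THE MIXED LETTER ∀ j ⟸ THE MIXED LETTER AT LEVEL `0`** (K-I's hM2, `j := 0` instance VERBATIM ⟹ every level, with the residual family
`levels Lc (RM 0)`, i.e. `RM′ j := wM2 3 Lc j • RM 0`; its class and parity follow from those of `RM 0` by `locStencilFM_levels`∕`parityOdd_levels`). -/
theorem mixed_all_of_zero (ρ : Fin 4 → ℤ) (cΛ : ℝ) {γ : ℕ → ℝ}
    (hγ : ∀ j, γ j = -((Lc : ℝ) ^ 8 / 2) * wVH 3 Lc j / (stepScale 3 Lc j * (Lc : ℝ) ^ 4))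
    {mixFF : Fin 4 → (Fin 4 → ℤ) → Fin 4 → (Fin 4 → ℤ) → MKer 4 (Fib 3)}
    {RM : ℕ → Fin 4 → Fin 4 → (Fin 4 → ℤ) → Fin 4 → (Fin 4 → ℤ) → MKer 4 (Fib 3)} (h0 : MixedAt Lc ρ cΛ γ mixFF RM 0) :
    ∀ j, MixedAt Lc ρ cΛ γ mixFF (levels Lc (RM 0)) j :=
  mixed_all_of_prim ρ cΛ hγ (mixed_prim_of_zero ρ cΛ hγ h0)

omit [NeZero Lc] in
/-- [folklore] The residual's `LocStencilFM` class scales along the levels. -/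
theorem locStencilFM_levels {RM₀ : Fin 4 → Fin 4 → (Fin 4 → ℤ) → Fin 4 → (Fin 4 → ℤ) → MKer 4 (Fib 3)}
    (h : ∀ α : Fin 4, ∃ C δ : ℝ, 0 < δ ∧ LocStencilFM Lc (RM₀ α) C δ) :
    ∀ (j : ℕ) (α : Fin 4), ∃ C δ : ℝ, 0 < δ ∧ LocStencilFM Lc (levels Lc RM₀ j α) C δ := by
  intro j α
  obtain ⟨C, δ, hδ, hC⟩ := h α
  refine ⟨|wM2 3 Lc j| * C, δ, hδ, fun κ u ρ' w => ?_⟩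
  have hb := biLoc_smul (wM2 3 Lc j) (hC κ u ρ' w)
  simpa only [levels, mul_assoc] using hb

omit [NeZero Lc] in
/-- [folklore] The residual's parity (odd) scales along the levels. -/
theorem parityOdd_levels {RM₀ : Fin 4 → Fin 4 → (Fin 4 → ℤ) → Fin 4 → (Fin 4 → ℤ) → MKer 4 (Fib 3)}
    (h : ∀ (α : Fin 4) κ u ρ' w, trK (RM₀ α κ u ρ' w) = -sgnK (RM₀ α κ u ρ' w)) :
    ∀ (j : ℕ) (α : Fin 4) κ u ρ' w, trK (levels Lc RM₀ j α κ u ρ' w) = -sgnK (levels Lc RM₀ j α κ u ρ' w) :=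
  fun j α κ u ρ' w => parityOdd_smul (wM2 3 Lc j) (h α κ u ρ' w)

end Mixed

/-! ## §5 The hR END over the level-`0` letters only -/

section Wall

variable {Lc : ℕ} [NeZero Lc]

/-- [folklore] **hR(v2.26-W, T := (8N²)⁻¹•wsym22 N, mixFF := mixFFAt ρ_c Lc) ⟸ an1's TWO LETTERS AT LEVEL `0` ONLY**: the border identity (B₀)
(`BorderPrim`) and the mixed identity (M₀) (`MixedPrim`) with a level-free odd `LocStencilFM` residual `RM₀`, plus lock2 and the border table's data —
`SpineRooted.axisReflectionCovariant_flipK_TbalOf_JsRecWAtOf_of_an1_letters` with hBe := `border_all_of_prim`, hM2 := `mixed_all_of_prim`. -/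
theorem axisReflectionCovariant_flipK_TbalOf_JsRecWAtOf_of_an1_letters₀ (hLc : Odd Lc) {N : ℕ} {C : Type*} [Fintype C] [DecidableEq C]
    {τ : C → Matrix (Fin N) (Fin N) ℂ} (hτ : Complete τ) (ho : TrOrthonormal τ) (hN : N ≠ 0) (c : C) (cΛ cE₂ cB : ℝ)
    {vh₂S : Fin 4 → (Fin 4 → ℤ) → Fin 4 → (Fin 4 → ℤ) → MKer 4 (Fib 3)} (hB : ∃ C δ : ℝ, 0 < δ ∧ LocStencil₂ vh₂S C δ)
    (hB0 : ∀ κ u κ' u' (x z : Fin 4 → ℤ) (β β' : Fin 4), vh₂S κ u κ' u' x z (Sum.inl β) (Sum.inl β') = 0)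
    (γ : ℕ → ℝ) (hγ : ∀ j, γ j = -((Lc : ℝ) ^ 8 / 2) * wVH 3 Lc j / (stepScale 3 Lc j * (Lc : ℝ) ^ 4))
    (hlock2 : ∀ j, cE₂ * wV4 3 Lc (j + 1) * wVH 3 Lc (j + 1) = ((Lc : ℝ) ^ 4 * wE 3 Lc (j + 1)) ^ 2)
    (RM₀ : Fin 4 → Fin 4 → (Fin 4 → ℤ) → Fin 4 → (Fin 4 → ℤ) → MKer 4 (Fib 3))
    -- (M₀) THE MIXED LETTER AT LEVEL 0
    (hM₀ : MixedPrim Lc (toSite (ctrOff 4 Lc)) cΛ (mixFFAt (toSite (ctrOff 4 Lc)) Lc) RM₀)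
    (hRM₀c : ∀ α : Fin 4, ∃ C δ : ℝ, 0 < δ ∧ LocStencilFM Lc (RM₀ α) C δ)
    (hRM₀p : ∀ (α : Fin 4) κ u ρ w, trK (RM₀ α κ u ρ w) = -sgnK (RM₀ α κ u ρ w))
    -- THE BORDER TABLE: anti-twin, no mm block, block translation, AND ITS LETTER AT LEVEL 0 (B₀)
    (hBat : ∀ κ u κ' u' (x z : Fin 4 → ℤ) (β m : Fin 4), vh₂S κ u κ' u' z x (Sum.inr m) (Sum.inl β) = -vh₂S κ u κ' u' x z (Sum.inl β) (Sum.inr m))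
    (hBmm0 : ∀ κ u κ' u' (x z : Fin 4 → ℤ) (m m' : Fin 4), vh₂S κ u κ' u' x z (Sum.inr m) (Sum.inr m') = 0)
    (hB₀ : BorderPrim Lc (toSite (ctrOff 4 Lc)) cB vh₂S)
    (hBt : ∀ (κ : Fin 4) (u : Fin 4 → ℤ) (κ' : Fin 4) (u' t : Fin 4 → ℤ),
      vh₂S κ (u + (Lc : ℤ) • t) κ' (u' + (Lc : ℤ) • t) = shiftK (-((Lc : ℤ) • t)) (vh₂S κ u κ' u'))
    :
    ∀ j : ℕ, AxisReflectionCovariant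
      (flipK (TbalOf Lc (JsRecWAtOf (d := 3) hLc.pos (ctrOff_mem_box hLc.pos) ((Lc : ℝ) ^ 4) (-((Lc : ℝ) ^ 8 / 2)) cΛ cE₂ cB ((8 * (N : ℝ) ^ 2)⁻¹ • wsym22 N) hB
        (hmix_an1 (d := 3) hLc.pos (ctrOff_mem_box hLc.pos))) j)) :=
  axisReflectionCovariant_flipK_TbalOf_JsRecWAtOf_of_an1_letters hLc hτ ho hN c cΛ cE₂ cB hB hB0 γ hγ hlock2 (levels Lc RM₀)
    (mixed_all_of_prim (toSite (ctrOff 4 Lc)) cΛ hγ hM₀) (locStencilFM_levels hRM₀c) (parityOdd_levels hRM₀p) hBat hBmm0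
    (border_all_of_prim (toSite (ctrOff 4 Lc)) cΛ cB hγ hB₀) hBt

/-- [folklore] **THE `SU(N)` INSTANCE, `N ≥ 2`, OVER THE LEVEL-`0` LETTERS** (colour basis := `ColourBasisSU.suGen N`). -/
theorem axisReflectionCovariant_flipK_TbalOf_JsRecWAtOf_of_an1_letters₀_suN (hLc : Odd Lc) {N : ℕ} (hN : 2 ≤ N) (cΛ cE₂ cB : ℝ)
    {vh₂S : Fin 4 → (Fin 4 → ℤ) → Fin 4 → (Fin 4 → ℤ) → MKer 4 (Fib 3)} (hB : ∃ C δ : ℝ, 0 < δ ∧ LocStencil₂ vh₂S C δ)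
    (hB0 : ∀ κ u κ' u' (x z : Fin 4 → ℤ) (β β' : Fin 4), vh₂S κ u κ' u' x z (Sum.inl β) (Sum.inl β') = 0)
    (γ : ℕ → ℝ) (hγ : ∀ j, γ j = -((Lc : ℝ) ^ 8 / 2) * wVH 3 Lc j / (stepScale 3 Lc j * (Lc : ℝ) ^ 4))
    (hlock2 : ∀ j, cE₂ * wV4 3 Lc (j + 1) * wVH 3 Lc (j + 1) = ((Lc : ℝ) ^ 4 * wE 3 Lc (j + 1)) ^ 2)
    (RM₀ : Fin 4 → Fin 4 → (Fin 4 → ℤ) → Fin 4 → (Fin 4 → ℤ) → MKer 4 (Fib 3))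
    (hM₀ : MixedPrim Lc (toSite (ctrOff 4 Lc)) cΛ (mixFFAt (toSite (ctrOff 4 Lc)) Lc) RM₀)
    (hRM₀c : ∀ α : Fin 4, ∃ C δ : ℝ, 0 < δ ∧ LocStencilFM Lc (RM₀ α) C δ)
    (hRM₀p : ∀ (α : Fin 4) κ u ρ w, trK (RM₀ α κ u ρ w) = -sgnK (RM₀ α κ u ρ w))
    (hBat : ∀ κ u κ' u' (x z : Fin 4 → ℤ) (β m : Fin 4), vh₂S κ u κ' u' z x (Sum.inr m) (Sum.inl β) = -vh₂S κ u κ' u' x z (Sum.inl β) (Sum.inr m))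
    (hBmm0 : ∀ κ u κ' u' (x z : Fin 4 → ℤ) (m m' : Fin 4), vh₂S κ u κ' u' x z (Sum.inr m) (Sum.inr m') = 0)
    (hB₀ : BorderPrim Lc (toSite (ctrOff 4 Lc)) cB vh₂S)
    (hBt : ∀ (κ : Fin 4) (u : Fin 4 → ℤ) (κ' : Fin 4) (u' t : Fin 4 → ℤ),
      vh₂S κ (u + (Lc : ℤ) • t) κ' (u' + (Lc : ℤ) • t) = shiftK (-((Lc : ℤ) • t)) (vh₂S κ u κ' u'))
    :
    ∀ j : ℕ, AxisReflectionCovariant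
      (flipK (TbalOf Lc (JsRecWAtOf (d := 3) hLc.pos (ctrOff_mem_box hLc.pos) ((Lc : ℝ) ^ 4) (-((Lc : ℝ) ^ 8 / 2)) cΛ cE₂ cB ((8 * (N : ℝ) ^ 2)⁻¹ • wsym22 N) hB
        (hmix_an1 (d := 3) hLc.pos (ctrOff_mem_box hLc.pos))) j)) :=
  axisReflectionCovariant_flipK_TbalOf_JsRecWAtOf_of_an1_letters_suN hLc hN cΛ cE₂ cB hB hB0 γ hγ hlock2 (levels Lc RM₀)
    (mixed_all_of_prim (toSite (ctrOff 4 Lc)) cΛ hγ hM₀) (locStencilFM_levels hRM₀c) (parityOdd_levels hRM₀p) hBat hBmm0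
    (border_all_of_prim (toSite (ctrOff 4 Lc)) cΛ cB hγ hB₀) hBt
end Wall
end Summit.QuantumFields.BalabanUV.Beta.SecondOrderLetterLevels
end
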